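import Literature.Analysis.DeBrangesSpaces.DeBranges1986CharacterSpacesProofs
import Literature.NumberTheory.LFunctions.DirichletThetaTransformation
import Mathlib.Analysis.SpecialFunctions.Gamma.Beta
import Mathlib.Analysis.SpecialFunctions.Gaussian.GaussianIntegral
import Mathlib.MeasureTheory.Function.JacobianOneDim
import Mathlib.MeasureTheory.Integral.IntegralEqImproper
import Mathlib.Analysis.Calculus.ParametricIntegral
import Mathlib.NumberTheory.LSeries.Convolution
import Mathlib.NumberTheory.LSeries.DirichletContinuation
import HarnessLib

/-!
LABEL: RH-FREE; bears_on: B-C/B-P (COLUMN 6 DBR). WHAT THIS IS NOT: not a step towards RH and not a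
claim about zeros of `ζ` or `L(s, χ)` inside the critical strip — everything below lives on
`Re s ≥ 1` (absolute convergence, the non-vanishing of `L(s, χ)` on `Re s ≥ 1`, the functional
equation); nothing here bears on the truth of RH.

# de Branges 1986, Theorem 4: the Mellin transform `W_χ` of `k_χ` — discharge of `deBranges1986_thm4`

For a primitive even character `χ` modulo `r ≠ 1`, de Branges [deBranges1986, Thm 3–4, pp. 10–12]
puts `k_χ(t) = Σ_{n² < t} φ(n) χ(n) n^{−1} (t − n²)^{−1/2}` and
`W_χ(z) = r^{−1/2} ∫₁^∞ k_χ(t) t^{(iz−1)/2} dt`, and states (Theorem 4) that `W_χ` is analytic and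
bounded by one in the upper half-plane and that
`(r/π)^{(1−iz)/2} Γ((1−iz)/2) L(1−iz, χ) W_χ(z) = ε(χ) (r/π)^{(1+iz)/2} Γ((1+iz)/2) L(1+iz, χ̄)`,
i.e. `ξ(1 − iz, χ) W_χ(z) = ε(χ) ξ(1 + iz, χ̄)` in the tree's notation (`dirichletXi`, `WChar`, `kChar`
of `DeBranges1986CharacterSpaces.lean`). This file proves the named fact `deBranges1986_thm4` as
typed there (`deBranges1986_thm4_holds`).

## Method, and where it deviates from print

de Branges obtains Theorem 4 from the isometric scattering transformations of his Theorems 1–3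
(mean-square Mellin theory). Here the Mellin transform is computed outright on the half-plane of
absolute convergence `Im z > 1` (`s = 1 − iz`, `Re s > 2`):

* termwise, `∫_{n²}^∞ t^{−s/2}(t − n²)^{−1/2} dt = n^{1−s} B((s−1)/2, ½)` (a Beta integral,
  DLMF (5.12.3)), so `∫₁^∞ k_χ(t) t^{−s/2} dt = B((s−1)/2, ½) Σ φ(n)χ(n) n^{−s}`
  (`integral_kChar_mul_cpow`, interchange by `integral_tsum` with the `ℓ¹` bound);
* `Σ φ(n) χ(n) n^{−s} = L(s−1, χ)/L(s, χ)` for `Re s > 2` (Apostol §11.4, `LSeries_totient_mul_char`);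
* `r^{−1/2} B((s−1)/2, ½) L(s−1,χ)/L(s,χ) · ξ(s, χ) = ξ(s−1, χ)` by `Γ(a)Γ(½)/Γ(a+½) = B(a, ½)` and the
  definition of `ξ` (even `χ`), and `ξ(s−1, χ) = ε(χ) ξ(2−s, χ̄)` is the functional equation
  (`dirichletXi_eq_rootNumber_mul_dirichletXi_inv_one_sub`) — this gives the identity for `Im z > 1`
  (`dirichletXi_mul_WChar_of_one_lt_im`);
* for `0 < Im z ≤ 1` the named fact carries the binder "`k_χ(t) t^{(iz−1)/2}` integrable on
  `(1, ∞)`"; under it `w ↦ ∫₁^∞ k_χ(t) t^{(iw−1)/2} dt` is holomorphic on `Im w > Im z`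
  (differentiation under the integral sign), continuous at `z` from above (dominated convergence),
  and the identity propagates from `Im w > 1` by the identity theorem (`dirichletXi_mul_WChar`);
* `|W_χ(z)| ≤ 1` is then `|ε(χ) ξ(1+iz, χ̄)| ≤ |ξ(1−iz, χ)|` (`deBranges1986_thm4_i`, proved in
  `DeBranges1986CharacterSpacesProofs.lean` by Phragmén–Lindelöf) divided by `ξ(1−iz, χ) ≠ 0`
  (`Re (1 − iz) > 1`).

So the logical order of print (bound ⇒ inequality) is reversed (inequality ⇒ bound); the statements
proved are the printed ones. No new definitions, no new named facts.

## References

* [deBranges1986] L. de Branges, *The Riemann hypothesis for Hilbert spaces of entire functions*,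
  Bull. AMS 15 (1986) 1–17, Theorems 3–4, pp. 10–12.
* [Apostol1976] T. M. Apostol, *Introduction to Analytic Number Theory*, §11.4 Example 4.
* [DLMF] NIST Digital Library of Mathematical Functions, (5.12.1), (5.12.3).
* [MontgomeryVaughan2007] H. L. Montgomery, R. C. Vaughan, *Multiplicative Number Theory I*, §10.1
  ((10.19): the completed `L`-function and its functional equation).
-/

noncomputable section

open scoped Real Topology
open Complex Filter Set MeasureTheory

namespace Literature.Analysis.DeBrangesSpaces
namespace DeBranges1986

open Literature.NumberTheory.LFunctions (charParity charParity_of_even)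
open Literature.NumberTheory.LFunctions.DirichletTheta

/-! ## The Beta integral behind `k_χ`: `∫_{a²}^∞ (t − a²)^{−1/2} t^{−s/2} dt = a^{1−s} B((s−1)/2, ½)` -/

/-- `√x = x^{1/2}` as a complex number, `x ≥ 0`. [folklore] -/
private theorem ofReal_sqrt_eq_cpow {x : ℝ} (hx : 0 ≤ x) :
    ((Real.sqrt x : ℝ) : ℂ) = (x : ℂ) ^ (1 / 2 : ℂ) := by
  rw [Real.sqrt_eq_rpow, Complex.ofReal_cpow hx]
  norm_num

/-- The substitution `u = 1/x` turns `u^{−s/2}(u − 1)^{−1/2} du` on `(1, ∞)` into the Beta integrand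
`x^{(s−1)/2 − 1}(1 − x)^{1/2 − 1} dx` on `(0, 1)` (Jacobian `x^{−2}`). [folklore] -/
private theorem inv_subst_pointwise (s : ℂ) {x : ℝ} (hx : x ∈ Ioo (0 : ℝ) 1) :
    |(-(x ^ 2)⁻¹ : ℝ)| • (((x⁻¹ : ℝ) : ℂ) ^ (-s / 2) / (Real.sqrt (x⁻¹ - 1) : ℂ)) =
      (x : ℂ) ^ ((s - 1) / 2 - 1) * (1 - (x : ℂ)) ^ (1 / 2 - 1 : ℂ) := by
  obtain ⟨hx0, hx1⟩ := hx
  have hx0' : (x : ℂ) ≠ 0 := by exact_mod_cast hx0.ne'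
  have h1x : 0 < 1 - x := by linarith
  have habs : |(-(x ^ 2)⁻¹ : ℝ)| = (x ^ 2)⁻¹ := by
    rw [abs_neg, abs_of_pos (by positivity)]
  have hinvpow : ((x⁻¹ : ℝ) : ℂ) ^ (-s / 2) = (x : ℂ) ^ (s / 2) := by
    rw [Complex.ofReal_inv, Complex.inv_cpow _ _ (by
      rw [Complex.arg_ofReal_of_nonneg hx0.le]; exact Real.pi_ne_zero.symm), neg_div,
      Complex.cpow_neg, inv_inv]
  have hsqrt : ((Real.sqrt (x⁻¹ - 1) : ℝ) : ℂ) =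
      (1 - (x : ℂ)) ^ (1 / 2 : ℂ) * (x : ℂ) ^ (-(1 / 2) : ℂ) := by
    have : (x⁻¹ - 1 : ℝ) = (1 - x) / x := by field_simp
    rw [this, Real.sqrt_div' _ hx0.le, Complex.ofReal_div, ofReal_sqrt_eq_cpow h1x.le,
      ofReal_sqrt_eq_cpow hx0.le, Complex.cpow_neg, div_eq_mul_inv]
    push_cast; ring
  rw [habs, hinvpow, hsqrt, Complex.real_smul]
  have e1 : (((x ^ 2)⁻¹ : ℝ) : ℂ) = (x : ℂ) ^ (-2 : ℂ) := by
    rw [Complex.cpow_neg, show (2 : ℂ) = ((2 : ℕ) : ℂ) by norm_num, Complex.cpow_natCast]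
    push_cast; ring
  have e3 : (x : ℂ) ^ (-(1 / 2) : ℂ) = ((x : ℂ) ^ (1 / 2 : ℂ))⁻¹ := Complex.cpow_neg _ _
  rw [e1, div_eq_mul_inv, mul_inv, e3, inv_inv, show (1 / 2 : ℂ) - 1 = -(1 / 2) by norm_num,
    Complex.cpow_neg (1 - (x : ℂ)), show (s - 1) / 2 - 1 = (-2) + (s / 2 + 1 / 2) by ring,
    Complex.cpow_add _ _ hx0', Complex.cpow_add _ _ hx0']
  ring

/-- `x ↦ 1/x` maps `(0, 1)` onto `(1, ∞)`. [folklore] -/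
private theorem image_inv_Ioo : (fun x : ℝ ↦ x⁻¹) '' Ioo (0 : ℝ) 1 = Ioi 1 := by
  rw [Set.image_inv_eq_inv, Set.inv_Ioo_0_left one_pos, inv_one]

/-- `(1/x)' = −1/x²` on `(0, 1)`. [folklore] -/
private theorem hasDerivWithinAt_inv_Ioo :
    ∀ x ∈ Ioo (0 : ℝ) 1, HasDerivWithinAt (fun x : ℝ ↦ x⁻¹) (-(x ^ 2)⁻¹) (Ioo (0 : ℝ) 1) x :=
  fun _ hx ↦ (hasDerivAt_inv hx.1.ne').hasDerivWithinAt

/-- `x ↦ 1/x` is injective on `(0, 1)`. [folklore] -/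
private theorem injOn_inv_Ioo : InjOn (fun x : ℝ ↦ x⁻¹) (Ioo (0 : ℝ) 1) :=
  fun _ _ _ _ h ↦ inv_injective h

/-- `∫₁^∞ u^{−s/2} (u − 1)^{−1/2} du = B((s−1)/2, ½)` (substitution `u = 1/x`; both sides are the honest
integrals when `Re s > 1`, and the identity of Bochner integrals holds for every `s`); this is
DLMF (5.12.3) `∫₀^∞ t^{a−1}(1+t)^{−a−b} dt = B(a, b)` at `a = ½`, `b = (s−1)/2`, `t = u − 1`, proved here
by reduction to (5.12.1). [cite: DLMF, (5.12.3); (5.12.1)] -/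
theorem integral_Ioi_one_cpow_div_sqrt (s : ℂ) :
    ∫ u in Ioi (1 : ℝ), (u : ℂ) ^ (-s / 2) / (Real.sqrt (u - 1) : ℂ) =
      Complex.betaIntegral ((s - 1) / 2) (1 / 2) := by
  rw [← image_inv_Ioo, integral_image_eq_integral_abs_deriv_smul measurableSet_Ioo
    hasDerivWithinAt_inv_Ioo injOn_inv_Ioo, Complex.betaIntegral,
    intervalIntegral.integral_of_le zero_le_one, integral_Ioc_eq_integral_Ioo]
  exact setIntegral_congr_fun measurableSet_Ioo (fun x hx ↦ inv_subst_pointwise s hx)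

/-- `u ↦ u^{−s/2}(u − 1)^{−1/2}` is integrable on `(1, ∞)` for `Re s > 1` (the Beta integrand with
exponents `(s−1)/2`, `½` is). [cite: DLMF, (5.12.3); (5.12.1)] -/
theorem integrableOn_Ioi_one_cpow_div_sqrt {s : ℂ} (hs : 1 < s.re) :
    IntegrableOn (fun u : ℝ ↦ (u : ℂ) ^ (-s / 2) / (Real.sqrt (u - 1) : ℂ)) (Ioi 1) := by
  rw [← image_inv_Ioo, integrableOn_image_iff_integrableOn_abs_deriv_smul measurableSet_Ioo
    hasDerivWithinAt_inv_Ioo injOn_inv_Ioo]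
  have hB := Complex.betaIntegral_convergent (u := (s - 1) / 2) (v := 1 / 2)
    (by simp only [Complex.div_ofNat_re, Complex.sub_re, Complex.one_re]; linarith)
    (by norm_num)
  rw [intervalIntegrable_iff_integrableOn_Ioo_of_le zero_le_one] at hB
  exact hB.congr_fun (fun x hx ↦ (inv_subst_pointwise s hx).symm) measurableSet_Ioo

/-- Scaling: `t^{−s/2}(t − a²)^{−1/2}` at `t = a²x` is `a^{−s−1} · x^{−s/2}(x − 1)^{−1/2}` (`a > 0`,
`x > 1`). [folklore] -/
private theorem scale_pointwise {a : ℝ} (ha : 0 < a) (s : ℂ) {x : ℝ} (hx : x ∈ Ioi (1 : ℝ)) :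
    ((a ^ 2 * x : ℝ) : ℂ) ^ (-s / 2) / (Real.sqrt (a ^ 2 * x - a ^ 2) : ℂ) =
      ((a : ℂ) ^ (-s) * (a : ℂ)⁻¹) * ((x : ℂ) ^ (-s / 2) / (Real.sqrt (x - 1) : ℂ)) := by
  have ha2 : 0 < a ^ 2 := pow_pos ha 2
  have hx0 : 0 ≤ x := by linarith [mem_Ioi.1 hx]
  have hlog : (Complex.log a * 2).im = 0 := by
    rw [show Complex.log a * 2 = ((Real.log a * 2 : ℝ) : ℂ) by
      rw [← Complex.ofReal_log ha.le]; push_cast; ring, Complex.ofReal_im]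
  have hpow : (((a ^ 2 * x : ℝ)) : ℂ) ^ (-s / 2) = (a : ℂ) ^ (-s) * (x : ℂ) ^ (-s / 2) := by
    rw [Complex.ofReal_mul, Complex.mul_cpow_ofReal_nonneg ha2.le hx0]
    congr 1
    push_cast
    rw [show ((a : ℂ) ^ 2) = (a : ℂ) ^ (2 : ℂ) from (Complex.cpow_two _).symm,
      ← Complex.cpow_mul _ (by rw [hlog]; linarith [Real.pi_pos]) (by rw [hlog]; exact Real.pi_pos.le)]
    congr 1; ring
  have hsq : Real.sqrt (a ^ 2 * x - a ^ 2) = a * Real.sqrt (x - 1) := by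
    rw [show a ^ 2 * x - a ^ 2 = a ^ 2 * (x - 1) by ring,
      Real.sqrt_mul' _ (by linarith [mem_Ioi.1 hx]), Real.sqrt_sq ha.le]
  rw [hpow, hsq]
  push_cast
  ring

/-- **`∫_{a²}^∞ t^{−s/2} (t − a²)^{−1/2} dt = a^{1−s} B((s−1)/2, ½)`** for `a > 0` (scaling `t = a²u`,
then `integral_Ioi_one_cpow_div_sqrt`; honest for `Re s > 1`). [cite: DLMF, (5.12.3)] -/
theorem integral_Ioi_sq_cpow_div_sqrt {a : ℝ} (ha : 0 < a) (s : ℂ) :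
    ∫ t in Ioi (a ^ 2), (t : ℂ) ^ (-s / 2) / (Real.sqrt (t - a ^ 2) : ℂ) =
      (a : ℂ) ^ (1 - s) * Complex.betaIntegral ((s - 1) / 2) (1 / 2) := by
  set g : ℝ → ℂ := fun t ↦ (t : ℂ) ^ (-s / 2) / (Real.sqrt (t - a ^ 2) : ℂ) with hg
  have ha2 : 0 < a ^ 2 := pow_pos ha 2
  have ha0 : (a : ℂ) ≠ 0 := by exact_mod_cast ha.ne'
  have h := integral_comp_mul_left_Ioi g 1 ha2
  rw [mul_one] at h
  have h' : ∫ t in Ioi (a ^ 2), g t = (a ^ 2 : ℝ) • ∫ x in Ioi (1 : ℝ), g (a ^ 2 * x) := by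
    rw [h, smul_smul, mul_inv_cancel₀ ha2.ne', one_smul]
  rw [h']
  have hpt : ∀ x ∈ Ioi (1 : ℝ), g (a ^ 2 * x) =
      ((a : ℂ) ^ (-s) * (a : ℂ)⁻¹) * ((x : ℂ) ^ (-s / 2) / (Real.sqrt (x - 1) : ℂ)) := by
    intro x hx
    rw [hg]
    dsimp only
    rw [← scale_pointwise ha s hx]
  rw [setIntegral_congr_fun measurableSet_Ioi hpt, integral_const_mul,
    integral_Ioi_one_cpow_div_sqrt s, Complex.real_smul,
    show (1 : ℂ) - s = 1 + (-s) by ring, Complex.cpow_add _ _ ha0, Complex.cpow_one]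
  push_cast
  field_simp

/-- … and the integrand is integrable on `(a², ∞)` when `Re s > 1`. [cite: DLMF, (5.12.3)] -/
theorem integrableOn_Ioi_sq_cpow_div_sqrt {a : ℝ} (ha : 0 < a) {s : ℂ} (hs : 1 < s.re) :
    IntegrableOn (fun t : ℝ ↦ (t : ℂ) ^ (-s / 2) / (Real.sqrt (t - a ^ 2) : ℂ)) (Ioi (a ^ 2)) := by
  have ha2 : 0 < a ^ 2 := pow_pos ha 2
  have h := (integrableOn_Ioi_comp_mul_left_iff
    (fun t : ℝ ↦ (t : ℂ) ^ (-s / 2) / (Real.sqrt (t - a ^ 2) : ℂ)) 1 ha2).1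
  rw [mul_one] at h
  apply h
  have hI : IntegrableOn (fun x : ℝ ↦ ((a : ℂ) ^ (-s) * (a : ℂ)⁻¹) *
      ((x : ℂ) ^ (-s / 2) / (Real.sqrt (x - 1) : ℂ))) (Ioi 1) :=
    (integrableOn_Ioi_one_cpow_div_sqrt hs).const_mul ((a : ℂ) ^ (-s) * (a : ℂ)⁻¹)
  exact hI.congr_fun (fun x hx ↦ (scale_pointwise ha s hx).symm) measurableSet_Ioi

/-! ## The Dirichlet series `Σ φ(n) χ(n) n^{−s} = L(s − 1, χ)/L(s, χ)` -/

open scoped LSeries.notation in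
/-- **`(Σ_{n≥1} φ(n) χ(n) n^{−s}) · L(s, χ) = L(s − 1, χ)`** for `Re s > 2` (Dirichlet convolution:
`Σ_{d∣n} φ(d) = n`; Apostol's Example 4 is the case `χ = 1`, the twist by the completely
multiplicative `χ` is the same computation, his Theorem 11.5).
[cite: Apostol1976, §11.4, Example 4; Theorem 11.5] -/
theorem LSeries_totient_mul_char_mul_LFunction {q : ℕ} [NeZero q] (χ : DirichletCharacter ℂ q)
    {s : ℂ} (hs : 2 < s.re) :
    LSeries (fun n ↦ (Nat.totient n : ℂ) * χ n) s * χ.LFunction s = χ.LFunction (s - 1) := by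
  set f : ℕ → ℂ := fun n ↦ (Nat.totient n : ℂ) * χ n with hf
  set g : ℕ → ℂ := fun n ↦ χ n with hg
  have hfs : LSeriesSummable f s := by
    refine LSeriesSummable_of_le_const_mul_rpow (x := 2) hs ⟨1, fun n _ ↦ ?_⟩
    rw [hf]; dsimp only
    rw [norm_mul, Complex.norm_natCast, show (2 : ℝ) - 1 = 1 by norm_num, Real.rpow_one, one_mul]
    calc (Nat.totient n : ℝ) * ‖χ n‖ ≤ n * 1 :=
        mul_le_mul (by exact_mod_cast Nat.totient_le n) (χ.norm_le_one _) (norm_nonneg _)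
          (Nat.cast_nonneg _)
      _ = n := mul_one _
  have hgs : LSeriesSummable g s := by
    refine LSeriesSummable_of_le_const_mul_rpow (x := 1) (by linarith) ⟨1, fun n _ ↦ ?_⟩
    rw [hg]; dsimp only
    rw [show (1 : ℝ) - 1 = 0 by norm_num, Real.rpow_zero, mul_one]
    exact χ.norm_le_one _
  have hconv : f ⍟ g = fun n : ℕ ↦ χ n * (n : ℂ) := by
    rw [LSeries.convolution_def]
    funext n
    rw [Nat.sum_divisorsAntidiagonal (fun i j ↦ f i * g j)]
    calc ∑ i ∈ n.divisors, f i * g (n / i) = ∑ i ∈ n.divisors, (Nat.totient i : ℂ) * χ n := by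
          refine Finset.sum_congr rfl fun i hi ↦ ?_
          rw [hf, hg]; dsimp only
          rw [mul_assoc, ← map_mul, ← Nat.cast_mul, Nat.mul_div_cancel' (Nat.dvd_of_mem_divisors hi)]
      _ = χ n * (n : ℂ) := by rw [← Finset.sum_mul, ← Nat.cast_sum, Nat.sum_totient, mul_comm]
  have hL : LSeries (f ⍟ g) s = LSeries f s * LSeries g s := LSeries_convolution' hfs hgs
  rw [hconv] at hL
  have h1 : 1 < s.re := by linarith
  have h1' : 1 < (s - 1).re := by simp only [Complex.sub_re, Complex.one_re]; linarith
  rw [DirichletCharacter.LFunction_eq_LSeries χ h1, DirichletCharacter.LFunction_eq_LSeries χ h1',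
    ← hL]
  unfold LSeries
  congr 1
  funext n
  rcases eq_or_ne n 0 with rfl | hn
  · simp [LSeries.term_zero]
  · rw [LSeries.term_of_ne_zero hn, LSeries.term_of_ne_zero hn,
      Complex.cpow_sub _ _ (by exact_mod_cast hn), Complex.cpow_one]
    have hn' : (n : ℂ) ≠ 0 := by exact_mod_cast hn
    have hns : (n : ℂ) ^ s ≠ 0 := by
      rw [Ne, Complex.cpow_eq_zero_iff, not_and_or]; exact Or.inl hn'
    field_simp

/-- **`Σ_{n≥1} φ(n) χ(n) n^{−s} = L(s − 1, χ)/L(s, χ)`** for `Re s > 2` (`L(s, χ) ≠ 0` there).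
[cite: Apostol1976, §11.4, Example 4] -/
theorem LSeries_totient_mul_char {q : ℕ} [NeZero q] (χ : DirichletCharacter ℂ q) {s : ℂ}
    (hs : 2 < s.re) :
    LSeries (fun n ↦ (Nat.totient n : ℂ) * χ n) s = χ.LFunction (s - 1) / χ.LFunction s := by
  have hne : χ.LFunction s ≠ 0 :=
    DirichletCharacter.LFunction_ne_zero_of_one_le_re χ (Or.inr (by
      rintro rfl; rw [Complex.one_re] at hs; linarith)) (by linarith)
  rw [eq_div_iff hne, LSeries_totient_mul_char_mul_LFunction χ hs]

/-! ## The Mellin transform of `k_χ` on `Re s > 2` -/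

variable {r : ℕ}

/-- `k_χ(t) t^{−s/2}` as a series over all `n` (the printed sum "over the positive integers `n` such
that `n² < t`", padded with zeros). [cite: deBranges1986, Theorem 3, p. 10] -/
private theorem kChar_mul_cpow_eq_tsum (χ : DirichletCharacter ℂ r) (s : ℂ) (t : ℝ) :
    kChar χ t * (t : ℂ) ^ (-s / 2) = ∑' n : ℕ,
      (if 0 < n ∧ ((n : ℕ) : ℝ) ^ 2 < t then
        (Nat.totient n : ℂ) * χ ((n : ℕ) : ZMod r) / ((n : ℕ) : ℂ) /
          (Real.sqrt (t - ((n : ℕ) : ℝ) ^ 2) : ℂ) * (t : ℂ) ^ (-s / 2) else 0) := by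
  unfold kChar
  rw [Finset.sum_mul]
  symm
  rw [tsum_eq_sum (s := (Finset.range (⌊t⌋₊ + 1)).filter
    (fun n : ℕ => 0 < n ∧ ((n : ℕ) : ℝ) ^ 2 < t))]
  · refine Finset.sum_congr rfl fun n hn ↦ ?_
    rw [Finset.mem_filter] at hn
    rw [if_pos hn.2]
  · intro n hn
    rw [Finset.mem_filter, Finset.mem_range, not_and] at hn
    by_cases hc : 0 < n ∧ ((n : ℕ) : ℝ) ^ 2 < t
    · exfalso
      refine hn ?_ hc
      have hn1 : (1 : ℝ) ≤ n := by exact_mod_cast hc.1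
      have hnt : (n : ℝ) < t := by nlinarith [hc.2]
      have ht0 : 0 ≤ t := by linarith
      have : n ≤ ⌊t⌋₊ := Nat.le_floor_iff ht0 |>.2 hnt.le
      omega
    · rw [if_neg hc]

/-- For `n ≥ 1` the `n`-th summand is the indicator of `(n², ∞)` times
`(φ(n)χ(n)/n) · t^{−s/2}(t − n²)^{−1/2}`. [folklore] -/
private theorem summand_eq_indicator (χ : DirichletCharacter ℂ r) (s : ℂ) {n : ℕ} (hn : 0 < n)
    (t : ℝ) :
    (if 0 < n ∧ ((n : ℕ) : ℝ) ^ 2 < t then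
        (Nat.totient n : ℂ) * χ ((n : ℕ) : ZMod r) / ((n : ℕ) : ℂ) /
          (Real.sqrt (t - ((n : ℕ) : ℝ) ^ 2) : ℂ) * (t : ℂ) ^ (-s / 2) else 0) =
      (Ioi (((n : ℕ) : ℝ) ^ 2)).indicator (fun t : ℝ ↦
        ((Nat.totient n : ℂ) * χ ((n : ℕ) : ZMod r) / ((n : ℕ) : ℂ)) *
          ((t : ℂ) ^ (-s / 2) / (Real.sqrt (t - ((n : ℕ) : ℝ) ^ 2) : ℂ))) t := by
  by_cases h : ((n : ℕ) : ℝ) ^ 2 < t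
  · rw [if_pos ⟨hn, h⟩, Set.indicator_of_mem (mem_Ioi.2 h)]; ring
  · rw [if_neg (fun h' ↦ h h'.2), Set.indicator_of_notMem (fun h' ↦ h (mem_Ioi.1 h'))]

/-- The integral of the `n`-th summand over `(1, ∞)` (`n ≥ 1`):
`(φ(n)χ(n)/n) · n^{1−s} B((s−1)/2, ½)`. [folklore] -/
private theorem integral_summand (χ : DirichletCharacter ℂ r) (s : ℂ) {n : ℕ} (hn : 0 < n) :
    ∫ t in Ioi (1 : ℝ), (if 0 < n ∧ ((n : ℕ) : ℝ) ^ 2 < t then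
        (Nat.totient n : ℂ) * χ ((n : ℕ) : ZMod r) / ((n : ℕ) : ℂ) /
          (Real.sqrt (t - ((n : ℕ) : ℝ) ^ 2) : ℂ) * (t : ℂ) ^ (-s / 2) else 0) =
      ((Nat.totient n : ℂ) * χ ((n : ℕ) : ZMod r) / ((n : ℕ) : ℂ)) *
        (((n : ℕ) : ℂ) ^ (1 - s) * Complex.betaIntegral ((s - 1) / 2) (1 / 2)) := by
  have hn1 : (1 : ℝ) ≤ ((n : ℕ) : ℝ) ^ 2 := by
    have : (1 : ℝ) ≤ n := by exact_mod_cast hn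
    nlinarith
  simp_rw [summand_eq_indicator χ s hn]
  rw [setIntegral_indicator measurableSet_Ioi, Ioi_inter_Ioi, sup_eq_right.2 hn1,
    integral_const_mul, integral_Ioi_sq_cpow_div_sqrt (by exact_mod_cast hn : (0 : ℝ) < n) s]
  simp only [Complex.ofReal_natCast]

/-- The norm of the `n`-th summand integrates over `(1, ∞)` to at most `n^{1−σ} |Re B((σ−1)/2, ½)|`
(`σ = Re s`, `n ≥ 1`; an identity of Bochner integrals, honest for `σ > 1`). [folklore] -/
private theorem integral_norm_summand_le (χ : DirichletCharacter ℂ r) (s : ℂ)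
    {n : ℕ} (hn : 0 < n) :
    ∫ t in Ioi (1 : ℝ), ‖(if 0 < n ∧ ((n : ℕ) : ℝ) ^ 2 < t then
        (Nat.totient n : ℂ) * χ ((n : ℕ) : ZMod r) / ((n : ℕ) : ℂ) /
          (Real.sqrt (t - ((n : ℕ) : ℝ) ^ 2) : ℂ) * (t : ℂ) ^ (-s / 2) else 0)‖ ≤
      ((n : ℕ) : ℝ) ^ (1 - s.re) *
        |(Complex.betaIntegral (((s.re : ℂ) - 1) / 2) (1 / 2)).re| := by
  set σ : ℝ := s.re with hσ
  have hn0 : (0 : ℝ) < n := by exact_mod_cast hn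
  have hn1 : (1 : ℝ) ≤ ((n : ℕ) : ℝ) ^ 2 := by
    have : (1 : ℝ) ≤ n := by exact_mod_cast hn
    nlinarith
  set c : ℂ := (Nat.totient n : ℂ) * χ ((n : ℕ) : ZMod r) / ((n : ℕ) : ℂ) with hc
  have hc1 : ‖c‖ ≤ 1 := by
    rw [hc, norm_div, norm_mul, Complex.norm_natCast, Complex.norm_natCast,
      div_le_one hn0]
    calc (Nat.totient n : ℝ) * ‖χ ((n : ℕ) : ZMod r)‖ ≤ n * 1 :=
        mul_le_mul (by exact_mod_cast Nat.totient_le n) (χ.norm_le_one _) (norm_nonneg _) hn0.le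
      _ = n := mul_one _
  -- the real integrand and its integral
  set g : ℝ → ℝ := fun t ↦ t ^ (-σ / 2) / Real.sqrt (t - ((n : ℕ) : ℝ) ^ 2) with hg
  have hgint : ∫ t in Ioi (((n : ℕ) : ℝ) ^ 2), g t =
      ((n : ℕ) : ℝ) ^ (1 - σ) * (Complex.betaIntegral (((σ : ℂ) - 1) / 2) (1 / 2)).re := by
    have hC := integral_Ioi_sq_cpow_div_sqrt hn0 (σ : ℂ)
    have hcongr : ∫ t in Ioi (((n : ℕ) : ℝ) ^ 2),
        ((t : ℂ) ^ (-(σ : ℂ) / 2) / (Real.sqrt (t - ((n : ℕ) : ℝ) ^ 2) : ℂ)) =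
        ∫ t in Ioi (((n : ℕ) : ℝ) ^ 2), ((g t : ℝ) : ℂ) := by
      refine setIntegral_congr_fun measurableSet_Ioi (fun t ht ↦ ?_)
      have ht0 : 0 ≤ t := le_trans (by positivity) (le_of_lt (mem_Ioi.1 ht))
      rw [hg]; dsimp only
      push_cast
      rw [Complex.ofReal_cpow ht0]
      push_cast
      ring_nf
    rw [hcongr, integral_complex_ofReal] at hC
    have hre := congrArg Complex.re hC
    rw [Complex.ofReal_re] at hre
    rw [hre, show (1 : ℂ) - (σ : ℂ) = ((1 - σ : ℝ) : ℂ) by push_cast; ring,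
      ← Complex.ofReal_cpow hn0.le, Complex.re_ofReal_mul]
  -- the norm of the summand is the indicator of `‖c‖ g`
  have hnorm : ∀ t ∈ Ioi (1 : ℝ), ‖(if 0 < n ∧ ((n : ℕ) : ℝ) ^ 2 < t then
        c / (Real.sqrt (t - ((n : ℕ) : ℝ) ^ 2) : ℂ) * (t : ℂ) ^ (-s / 2) else 0)‖ =
      (Ioi (((n : ℕ) : ℝ) ^ 2)).indicator (fun t ↦ ‖c‖ * g t) t := by
    intro t ht
    have ht0 : 0 < t := lt_trans one_pos (mem_Ioi.1 ht)
    by_cases h : ((n : ℕ) : ℝ) ^ 2 < t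
    · rw [if_pos ⟨hn, h⟩, Set.indicator_of_mem (mem_Ioi.2 h), hg]
      dsimp only
      rw [norm_mul, norm_div, Complex.norm_real, Real.norm_of_nonneg (Real.sqrt_nonneg _),
        Complex.norm_cpow_eq_rpow_re_of_pos ht0]
      simp only [Complex.neg_re, Complex.div_ofNat_re, neg_div]
      rw [hσ]; ring
    · rw [if_neg (fun h' ↦ h h'.2), Set.indicator_of_notMem (fun h' ↦ h (mem_Ioi.1 h')),
        norm_zero]
  rw [setIntegral_congr_fun measurableSet_Ioi hnorm, setIntegral_indicator measurableSet_Ioi,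
    Ioi_inter_Ioi, sup_eq_right.2 hn1, integral_const_mul, hgint]
  have hpow : 0 < ((n : ℕ) : ℝ) ^ (1 - σ) := Real.rpow_pos_of_pos hn0 _
  calc ‖c‖ * (((n : ℕ) : ℝ) ^ (1 - σ) * (Complex.betaIntegral (((σ : ℂ) - 1) / 2) (1 / 2)).re)
      ≤ ‖c‖ * (((n : ℕ) : ℝ) ^ (1 - σ) * |(Complex.betaIntegral (((σ : ℂ) - 1) / 2) (1 / 2)).re|) := by
        apply mul_le_mul_of_nonneg_left _ (norm_nonneg _)
        exact mul_le_mul_of_nonneg_left (le_abs_self _) hpow.le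
    _ ≤ 1 * (((n : ℕ) : ℝ) ^ (1 - σ) * |(Complex.betaIntegral (((σ : ℂ) - 1) / 2) (1 / 2)).re|) :=
        mul_le_mul_of_nonneg_right hc1 (by positivity)
    _ = _ := one_mul _

/-- **The Mellin transform of `k_χ` on `Re s > 2`**:
`∫₁^∞ k_χ(t) t^{−s/2} dt = B((s−1)/2, ½) · L(s−1, χ)/L(s, χ)` — termwise integration of
`k_χ(t) = Σ_{n² < t} φ(n)χ(n) n^{−1}(t − n²)^{−1/2}` (absolutely convergent double integral for
`Re s > 2`), the Beta integral `integral_Ioi_sq_cpow_div_sqrt`, and `Σ φ(n)χ(n)n^{−s} = L(s−1,χ)/L(s,χ)`.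
This is de Branges' "estimate of Mellin transforms" identity of Theorem 4 in the half-plane of
absolute convergence. [cite: deBranges1986, Theorem 4, pp. 11–12] -/
theorem integral_kChar_mul_cpow [NeZero r] (χ : DirichletCharacter ℂ r) {s : ℂ} (hs : 2 < s.re) :
    ∫ t in Ioi (1 : ℝ), kChar χ t * (t : ℂ) ^ (-s / 2) =
      Complex.betaIntegral ((s - 1) / 2) (1 / 2) * (χ.LFunction (s - 1) / χ.LFunction s) := by
  set B : ℂ := Complex.betaIntegral ((s - 1) / 2) (1 / 2) with hB
  set F : ℕ → ℝ → ℂ := fun n t ↦ (if 0 < n ∧ ((n : ℕ) : ℝ) ^ 2 < t then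
        (Nat.totient n : ℂ) * χ ((n : ℕ) : ZMod r) / ((n : ℕ) : ℂ) /
          (Real.sqrt (t - ((n : ℕ) : ℝ) ^ 2) : ℂ) * (t : ℂ) ^ (-s / 2) else 0) with hF
  have hF0 : F 0 = fun _ ↦ 0 := by
    funext t; rw [hF]; dsimp only; rw [if_neg (fun h ↦ lt_irrefl 0 h.1)]
  -- integrability of the summands on `(1, ∞)`
  have hint : ∀ n, Integrable (F n) (volume.restrict (Ioi (1 : ℝ))) := by
    intro n
    rcases Nat.eq_zero_or_pos n with rfl | hn
    · rw [hF0]; exact integrable_zero _ _ _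
    · have hn0 : (0 : ℝ) < n := by exact_mod_cast hn
      have hFn : F n = (Ioi (((n : ℕ) : ℝ) ^ 2)).indicator (fun t : ℝ ↦
          ((Nat.totient n : ℂ) * χ ((n : ℕ) : ZMod r) / ((n : ℕ) : ℂ)) *
            ((t : ℂ) ^ (-s / 2) / (Real.sqrt (t - ((n : ℕ) : ℝ) ^ 2) : ℂ))) :=
        funext (summand_eq_indicator χ s hn)
      rw [hFn]
      have hI : IntegrableOn (fun t : ℝ ↦
          ((Nat.totient n : ℂ) * χ ((n : ℕ) : ZMod r) / ((n : ℕ) : ℂ)) *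
            ((t : ℂ) ^ (-s / 2) / (Real.sqrt (t - ((n : ℕ) : ℝ) ^ 2) : ℂ))) (Ioi (((n : ℕ) : ℝ) ^ 2)) :=
        (integrableOn_Ioi_sq_cpow_div_sqrt hn0 (by linarith : 1 < s.re)).const_mul _
      exact (hI.integrable_indicator measurableSet_Ioi).integrableOn
  -- summability of the norms
  have hsum : Summable fun n ↦ ∫ t in Ioi (1 : ℝ), ‖F n t‖ := by
    refine Summable.of_nonneg_of_le (fun n ↦ integral_nonneg fun t ↦ norm_nonneg _)
      (fun n ↦ ?_) ((Real.summable_nat_rpow.2 (by linarith : 1 - s.re < -1)).mul_right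
        |(Complex.betaIntegral (((s.re : ℂ) - 1) / 2) (1 / 2)).re|)
    rcases Nat.eq_zero_or_pos n with rfl | hn
    · rw [hF0]
      simp only [norm_zero, integral_zero, Nat.cast_zero]
      rw [Real.zero_rpow (by linarith : (1 : ℝ) - s.re ≠ 0), zero_mul]
    · exact integral_norm_summand_le χ s hn
  -- termwise integration
  have hterm : ∀ n, ∫ t in Ioi (1 : ℝ), F n t =
      B * LSeries.term (fun n ↦ (Nat.totient n : ℂ) * χ n) s n := by
    intro n
    rcases Nat.eq_zero_or_pos n with rfl | hn
    · rw [hF0, LSeries.term_zero]; simp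
    · have hn' : (n : ℂ) ≠ 0 := by exact_mod_cast hn.ne'
      have hns : (n : ℂ) ^ s ≠ 0 := by
        rw [Ne, Complex.cpow_eq_zero_iff, not_and_or]; exact Or.inl hn'
      rw [hF]
      dsimp only
      rw [integral_summand χ s hn, LSeries.term_of_ne_zero hn.ne', Complex.cpow_sub _ _ hn',
        Complex.cpow_one, hB]
      field_simp
  calc ∫ t in Ioi (1 : ℝ), kChar χ t * (t : ℂ) ^ (-s / 2)
      = ∫ t in Ioi (1 : ℝ), ∑' n, F n t := by
        refine setIntegral_congr_fun measurableSet_Ioi (fun t _ ↦ ?_)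
        rw [hF]
        exact kChar_mul_cpow_eq_tsum χ s t
    _ = ∑' n, ∫ t in Ioi (1 : ℝ), F n t := (integral_tsum_of_summable_integral_norm hint hsum).symm
    _ = ∑' n, B * LSeries.term (fun n ↦ (Nat.totient n : ℂ) * χ n) s n := tsum_congr hterm
    _ = B * LSeries (fun n ↦ (Nat.totient n : ℂ) * χ n) s := by rw [tsum_mul_left]; rfl
    _ = B * (χ.LFunction (s - 1) / χ.LFunction s) := by rw [LSeries_totient_mul_char χ hs]

/-! ## From `B((s−1)/2, ½) L(s−1)/L(s)` to `ξ(s−1, χ)/ξ(s, χ)` -/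

/-- `(r/π)^{−1/2} = r^{−1/2} π^{1/2}` for the positive reals `r, π`. [folklore] -/
private theorem div_pi_cpow_neg_half {x : ℝ} (hx : 0 < x) :
    ((x : ℂ) / π) ^ (-(1 / 2) : ℂ) = (x : ℂ) ^ (-(1 / 2) : ℂ) * (π : ℂ) ^ (1 / 2 : ℂ) := by
  have hπ : (0 : ℝ) ≤ π⁻¹ := inv_nonneg.2 Real.pi_pos.le
  rw [div_eq_mul_inv, show ((π : ℂ))⁻¹ = ((π⁻¹ : ℝ) : ℂ) by push_cast; ring,
    Complex.mul_cpow_ofReal_nonneg hx.le hπ, Complex.ofReal_inv,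
    Complex.inv_cpow _ _ (by rw [Complex.arg_ofReal_of_nonneg Real.pi_pos.le]; exact Real.pi_ne_zero.symm)]
  congr 1
  rw [Complex.cpow_neg, inv_inv]

/-- **`r^{−1/2} B((s−1)/2, ½) · L(s−1,χ)/L(s,χ) · ξ(s, χ) = ξ(s−1, χ)`** for an even `χ ≠ 1` mod `r`
and `Re s > 1`: Gamma-factor bookkeeping (`Γ((s−1)/2)Γ(½) = Γ(s/2)B((s−1)/2, ½)`, `Γ(½) = √π`,
MV (10.19)). [cite: MontgomeryVaughan2007, (10.19)] -/
theorem rpow_mul_beta_mul_LFunction_div_mul_dirichletXi [NeZero r] {χ : DirichletCharacter ℂ r}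
    (h1 : χ ≠ 1) (heven : χ.Even) {s : ℂ} (hs : 1 < s.re) :
    (r : ℂ) ^ (-(1 / 2) : ℂ) * (Complex.betaIntegral ((s - 1) / 2) (1 / 2) *
      (χ.LFunction (s - 1) / χ.LFunction s)) * dirichletXi χ s = dirichletXi χ (s - 1) := by
  have hκ : charParity χ = 0 := charParity_of_even heven
  have hL : χ.LFunction s ≠ 0 :=
    DirichletCharacter.LFunction_ne_zero_of_one_le_re χ (Or.inr (by
      rintro rfl; rw [Complex.one_re] at hs; exact lt_irrefl _ hs)) hs.le
  have hs' : ∀ n : ℕ, s + charParity χ ≠ -(2 * (n : ℂ)) := by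
    intro n h; have := congrArg Complex.re h
    simp [hκ] at this; linarith [(n.cast_nonneg (α := ℝ))]
  have hs1' : ∀ n : ℕ, (s - 1) + charParity χ ≠ -(2 * (n : ℂ)) := by
    intro n h; have := congrArg Complex.re h
    simp [hκ] at this; linarith [(n.cast_nonneg (α := ℝ))]
  have hΓ : Complex.Gamma ((s - 1) / 2) * Complex.Gamma (1 / 2) =
      Complex.Gamma (s / 2) * Complex.betaIntegral ((s - 1) / 2) (1 / 2) := by
    have h := Complex.Gamma_mul_Gamma_eq_betaIntegral (s := (s - 1) / 2) (t := 1 / 2)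
      (by simp only [Complex.div_ofNat_re, Complex.sub_re, Complex.one_re]; linarith)
      (by norm_num)
    rw [h]; congr 2; ring
  have hΓ0 : Complex.Gamma (s / 2) ≠ 0 :=
    Complex.Gamma_ne_zero_of_re_pos (by simp only [Complex.div_ofNat_re]; linarith)
  have hB : Complex.betaIntegral ((s - 1) / 2) (1 / 2) =
      Complex.Gamma ((s - 1) / 2) * (π : ℂ) ^ (1 / 2 : ℂ) / Complex.Gamma (s / 2) := by
    rw [← Complex.Gamma_one_half_eq, eq_div_iff hΓ0, mul_comm _ (Complex.Gamma (s / 2)), hΓ]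
  rw [dirichletXi_eq_LFunction_mul h1 hs', dirichletXi_eq_LFunction_mul h1 hs1', hκ, Nat.cast_zero,
    add_zero, add_zero, hB]
  have hr0 : (0 : ℝ) < r := Nat.cast_pos.2 (NeZero.pos r)
  have hP0 : ((r : ℂ) / π) ≠ 0 := by
    apply div_ne_zero
    · exact_mod_cast hr0.ne'
    · exact_mod_cast Real.pi_ne_zero
  have hsplit : ((r : ℂ) / π) ^ ((s - 1) / 2) = ((r : ℂ) / π) ^ (s / 2) * ((r : ℂ) / π) ^ (-(1 / 2) : ℂ) := by
    rw [← Complex.cpow_add _ _ hP0]; congr 1; ring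
  have hhalf := div_pi_cpow_neg_half hr0
  push_cast at hhalf
  rw [hsplit, hhalf]
  field_simp

/-- **de Branges' Theorem 4 identity in the half-plane of absolute convergence**: for a primitive even
`χ` mod `r ≠ 1` and `Im z > 1`, `ξ(1 − iz, χ) W_χ(z) = ε(χ) ξ(1 + iz, χ̄)`
(`W_χ(z) = r^{−1/2} ∫₁^∞ k_χ(t) t^{(iz−1)/2} dt`). [cite: deBranges1986, Theorem 4, pp. 11–12] -/
theorem dirichletXi_mul_WChar_of_one_lt_im [NeZero r] {χ : DirichletCharacter ℂ r} (hr : r ≠ 1)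
    (hχ : χ.IsPrimitive) (heven : χ.Even) {z : ℂ} (hz : 1 < z.im) :
    dirichletXi χ (1 - I * z) * WChar χ z = χ.rootNumber * dirichletXi χ⁻¹ (1 + I * z) := by
  have h1 : χ ≠ 1 := by
    rintro rfl
    rw [DirichletCharacter.isPrimitive_def, DirichletCharacter.conductor_one] at hχ
    exact hr hχ.symm
  set s : ℂ := 1 - I * z with hs
  have hsre : 2 < s.re := by
    rw [hs]; simp only [Complex.sub_re, Complex.one_re, Complex.mul_re, Complex.I_re, Complex.I_im,
      zero_mul, one_mul, zero_sub]; linarith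
  have hexp : (I * z - 1) / 2 = -s / 2 := by rw [hs]; ring
  have hW : WChar χ z = (r : ℂ) ^ (-(1 / 2) : ℂ) *
      (Complex.betaIntegral ((s - 1) / 2) (1 / 2) * (χ.LFunction (s - 1) / χ.LFunction s)) := by
    rw [WChar, ← integral_kChar_mul_cpow χ hsre]
    congr 1
    refine setIntegral_congr_fun measurableSet_Ioi (fun t _ ↦ ?_)
    rw [hexp]
  have hFE : dirichletXi χ (s - 1) = χ.rootNumber * dirichletXi χ⁻¹ (1 + I * z) := by
    rw [dirichletXi_eq_rootNumber_mul_dirichletXi_inv_one_sub hχ (s - 1), hs]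
    congr 2; ring
  rw [hW, mul_comm, rpow_mul_beta_mul_LFunction_div_mul_dirichletXi h1 heven (by linarith), hFE]

/-! ## Analytic continuation in `z` down to `Im z > 0` under the integrability binder -/

/-- `d/dw t^{(iw−1)/2} = t^{(iw−1)/2} · log t · (i/2)` (`t > 0`). [folklore] -/
private theorem hasDerivAt_cpow_exponent {t : ℝ} (ht : 0 < t) (w : ℂ) :
    HasDerivAt (fun w : ℂ ↦ (t : ℂ) ^ ((I * w - 1) / 2))
      ((t : ℂ) ^ ((I * w - 1) / 2) * Complex.log t * (I / 2)) w := by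
  have hf : HasDerivAt (fun w : ℂ ↦ (I * w - 1) / 2) (I / 2) w := by
    have := (((hasDerivAt_id w).const_mul I).sub_const 1).div_const 2
    simpa using this
  exact hf.const_cpow (Or.inl (by exact_mod_cast ht.ne'))

/-- `|t^{(iw−1)/2}| = t^{(−Im w − 1)/2}` (`t > 0`). [folklore] -/
private theorem norm_cpow_exponent {t : ℝ} (ht : 0 < t) (w : ℂ) :
    ‖(t : ℂ) ^ ((I * w - 1) / 2)‖ = t ^ ((-w.im - 1) / 2) := by
  rw [Complex.norm_cpow_eq_rpow_re_of_pos ht]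
  congr 1
  simp only [Complex.div_ofNat_re, Complex.sub_re, Complex.mul_re, Complex.I_re, Complex.I_im,
    Complex.one_re, zero_mul, one_mul, zero_sub]

/-- **de Branges 1986, Theorem 4, the Mellin identity on the printed range**: for a primitive even
`χ` mod `r ≠ 1` and `Im z > 0` such that `k_χ(t) t^{(iz−1)/2}` is integrable on `(1, ∞)` (the binder
of the named fact — in print the integral is a mean-square Mellin transform; absolute convergence is
automatic for `Im z > 1`), `ξ(1 − iz, χ) W_χ(z) = ε(χ) ξ(1 + iz, χ̄)`. Proof: for `Im z > 1` this is
`dirichletXi_mul_WChar_of_one_lt_im`; for `0 < Im z ≤ 1` the function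
`w ↦ ∫₁^∞ k_χ(t) t^{(iw−1)/2} dt` is holomorphic on `Im w > Im z` (differentiation under the integral,
dominated by `|k_χ(t)| t^{(−Im z − 1)/2}`), agrees with the closed form on `Im w > 1`, hence on
`Im w > Im z` (identity theorem), and is continuous at `z` from above (dominated convergence).
[cite: deBranges1986, Theorem 4, pp. 11–12] -/
theorem dirichletXi_mul_WChar [NeZero r] {χ : DirichletCharacter ℂ r} (hr : r ≠ 1)
    (hχ : χ.IsPrimitive) (heven : χ.Even) {z : ℂ} (hz : 0 < z.im)
    (hint : IntegrableOn (fun t : ℝ ↦ kChar χ t * (t : ℂ) ^ ((I * z - 1) / 2)) (Ioi 1)) :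
    dirichletXi χ (1 - I * z) * WChar χ z = χ.rootNumber * dirichletXi χ⁻¹ (1 + I * z) := by
  rcases lt_or_ge 1 z.im with hz1 | hz1
  · exact dirichletXi_mul_WChar_of_one_lt_im hr hχ heven hz1
  have h1 : χ ≠ 1 := by
    rintro rfl
    rw [DirichletCharacter.isPrimitive_def, DirichletCharacter.conductor_one] at hχ
    exact hr hχ.symm
  have h1' : χ⁻¹ ≠ 1 := by rwa [Ne, inv_eq_one]
  set y₀ : ℝ := z.im with hy₀
  set F : ℂ → ℝ → ℂ := fun w t ↦ kChar χ t * (t : ℂ) ^ ((I * w - 1) / 2) with hF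
  set Φ : ℂ → ℂ := fun w ↦ ∫ t in Ioi (1 : ℝ), F w t with hΦ
  set D : ℂ → ℂ := fun w ↦ dirichletXi χ (1 - I * w) * ((r : ℂ) ^ (-(1 / 2 : ℂ)) * Φ w) -
    χ.rootNumber * dirichletXi χ⁻¹ (1 + I * w) with hD
  suffices hDz : D z = 0 by
    have : WChar χ z = (r : ℂ) ^ (-(1 / 2 : ℂ)) * Φ z := rfl
    rw [this]
    exact sub_eq_zero.1 hDz
  set μ : Measure ℝ := volume.restrict (Ioi (1 : ℝ)) with hμ
  -- measurability of `k_χ` on `(1, ∞)`, read off from the integrability binder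
  have hK : AEStronglyMeasurable (fun t : ℝ ↦ kChar χ t) μ := by
    have hm : AEStronglyMeasurable (fun t : ℝ ↦ F z t * (t : ℂ) ^ (-((I * z - 1) / 2))) μ :=
      hint.aestronglyMeasurable.mul (Complex.measurable_ofReal.pow_const _).aestronglyMeasurable
    refine hm.congr ?_
    filter_upwards [ae_restrict_mem measurableSet_Ioi] with t ht
    have ht0 : (t : ℂ) ≠ 0 := by exact_mod_cast (lt_trans one_pos (mem_Ioi.1 ht)).ne'
    rw [hF]; dsimp only
    rw [mul_assoc, ← Complex.cpow_add _ _ ht0, add_neg_cancel, Complex.cpow_zero, mul_one]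
  have hFmeas : ∀ w, AEStronglyMeasurable (F w) μ := fun w ↦
    hK.mul (Complex.measurable_ofReal.pow_const _).aestronglyMeasurable
  have hFnorm : ∀ w, ∀ t ∈ Ioi (1 : ℝ), ‖F w t‖ = ‖kChar χ t‖ * t ^ ((-w.im - 1) / 2) := by
    intro w t ht
    rw [hF]; dsimp only
    rw [norm_mul, norm_cpow_exponent (lt_trans one_pos (mem_Ioi.1 ht))]
  have hdom : ∀ w : ℂ, y₀ ≤ w.im → ∀ t ∈ Ioi (1 : ℝ), ‖F w t‖ ≤ ‖F z t‖ := by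
    intro w hw t ht
    rw [hFnorm w t ht, hFnorm z t ht]
    refine mul_le_mul_of_nonneg_left ?_ (norm_nonneg _)
    exact Real.rpow_le_rpow_of_exponent_le (le_of_lt (mem_Ioi.1 ht)) (by linarith)
  have hbound_int : Integrable (fun t ↦ ‖F z t‖) μ := hint.norm
  -- (A) `Φ` is holomorphic on `U = {Im w > y₀}`
  have hΦdiff : DifferentiableOn ℂ Φ {w : ℂ | y₀ < w.im} := by
    intro w₁ hw₁
    have hw₁' : y₀ < w₁.im := hw₁
    set ε : ℝ := (w₁.im - y₀) / 2 with hε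
    have hε0 : 0 < ε := by rw [hε]; linarith
    set S : Set ℂ := {w : ℂ | y₀ + ε < w.im} with hS
    have hSmem : S ∈ 𝓝 w₁ := by
      refine (isOpen_lt continuous_const Complex.continuous_im).mem_nhds ?_
      show y₀ + ε < w₁.im
      rw [hε]; linarith
    set F' : ℂ → ℝ → ℂ := fun w t ↦
      kChar χ t * ((t : ℂ) ^ ((I * w - 1) / 2) * Complex.log t * (I / 2)) with hF'
    have hF'meas : AEStronglyMeasurable (F' w₁) μ := by
      refine hK.mul (Measurable.aestronglyMeasurable ?_)
      exact ((Complex.measurable_ofReal.pow_const _).mul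
        (Complex.measurable_log.comp Complex.measurable_ofReal)).mul_const _
    have hF_int : Integrable (F w₁) μ :=
      Integrable.mono' hbound_int (hFmeas w₁) (by
        filter_upwards [ae_restrict_mem measurableSet_Ioi] with t ht
        exact hdom w₁ hw₁'.le t ht)
    have h_bound : ∀ᵐ t ∂μ, ∀ w ∈ S, ‖F' w t‖ ≤ ε⁻¹ * ‖F z t‖ := by
      filter_upwards [ae_restrict_mem measurableSet_Ioi] with t ht w hw
      have ht1 : 1 < t := mem_Ioi.1 ht
      have ht0 : 0 < t := lt_trans one_pos ht1
      have hw' : y₀ + ε < w.im := hw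
      have hlog : ‖Complex.log t‖ = Real.log t := by
        rw [← Complex.ofReal_log ht0.le, Complex.norm_real, Real.norm_of_nonneg (Real.log_nonneg ht1.le)]
      have hlogle : Real.log t ≤ t ^ (ε / 2) / (ε / 2) := Real.log_le_rpow_div ht0.le (by positivity)
      rw [hF', hFnorm z t ht]
      dsimp only
      rw [norm_mul, norm_mul, norm_mul, norm_cpow_exponent ht0, hlog, norm_div, Complex.norm_I,
        Complex.norm_ofNat]
      -- t^{(−Im w −1)/2} ≤ t^{(−y₀−1)/2} · t^{−ε/2}
      have hsplit : t ^ ((-w.im - 1) / 2) ≤ t ^ ((-y₀ - 1) / 2) * t ^ (-(ε / 2)) := by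
        rw [← Real.rpow_add ht0]
        exact Real.rpow_le_rpow_of_exponent_le ht1.le (by linarith)
      have hprod : t ^ (-(ε / 2)) * Real.log t ≤ 2 / ε := by
        calc t ^ (-(ε / 2)) * Real.log t ≤ t ^ (-(ε / 2)) * (t ^ (ε / 2) / (ε / 2)) :=
            mul_le_mul_of_nonneg_left hlogle (by positivity)
          _ = 2 / ε := by
              rw [Real.rpow_neg ht0.le]
              field_simp
      have hk0 : 0 ≤ ‖kChar χ t‖ := norm_nonneg _
      have hA0 : 0 ≤ t ^ ((-y₀ - 1) / 2) := by positivity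
      calc ‖kChar χ t‖ * (t ^ ((-w.im - 1) / 2) * Real.log t * (1 / 2))
          ≤ ‖kChar χ t‖ * (t ^ ((-y₀ - 1) / 2) * t ^ (-(ε / 2)) * Real.log t * (1 / 2)) := by
            gcongr
            exact Real.log_nonneg ht1.le
        _ = ‖kChar χ t‖ * t ^ ((-y₀ - 1) / 2) * ((t ^ (-(ε / 2)) * Real.log t) * (1 / 2)) := by ring
        _ ≤ ‖kChar χ t‖ * t ^ ((-y₀ - 1) / 2) * ((2 / ε) * (1 / 2)) := by gcongr
        _ = ε⁻¹ * (‖kChar χ t‖ * t ^ ((-y₀ - 1) / 2)) := by field_simp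
    have h_diff : ∀ᵐ t ∂μ, ∀ w ∈ S, HasDerivAt (F · t) (F' w t) w := by
      filter_upwards [ae_restrict_mem measurableSet_Ioi] with t ht w _
      have ht0 : 0 < t := lt_trans one_pos (mem_Ioi.1 ht)
      rw [hF, hF']
      exact (hasDerivAt_cpow_exponent ht0 w).const_mul (kChar χ t)
    have key := hasDerivAt_integral_of_dominated_loc_of_deriv_le (μ := μ) (F := F) (x₀ := w₁)
      (bound := fun t ↦ ε⁻¹ * ‖F z t‖) hSmem (Eventually.of_forall hFmeas) hF_int hF'meas
      h_bound (hbound_int.const_mul _) h_diff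
    exact key.2.differentiableAt.differentiableWithinAt
  -- (B) `D` is analytic on `U` and vanishes on `Im w > 1`, hence on `U`
  have hU : IsOpen {w : ℂ | y₀ < w.im} := isOpen_lt continuous_const Complex.continuous_im
  have hUc : IsPreconnected {w : ℂ | y₀ < w.im} := (convex_halfSpace_im_gt y₀).isPreconnected
  have hξ1 : Differentiable ℂ (fun w : ℂ ↦ dirichletXi χ (1 - I * w)) :=
    (differentiable_dirichletXi h1).comp (by fun_prop)
  have hξ2 : Differentiable ℂ (fun w : ℂ ↦ dirichletXi χ⁻¹ (1 + I * w)) :=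
    (differentiable_dirichletXi h1').comp (by fun_prop)
  have hDdiff : DifferentiableOn ℂ D {w : ℂ | y₀ < w.im} :=
    (hξ1.differentiableOn.mul ((differentiableOn_const _).mul hΦdiff)).sub
      ((differentiableOn_const _).mul hξ2.differentiableOn)
  have hDan : AnalyticOnNhd ℂ D {w : ℂ | y₀ < w.im} := hDdiff.analyticOnNhd hU
  have hz₁ : z + 2 * I ∈ {w : ℂ | y₀ < w.im} := by
    show y₀ < (z + 2 * I).im
    simp [hy₀]
  have hDev : D =ᶠ[𝓝 (z + 2 * I)] 0 := by
    have hopen : IsOpen {w : ℂ | 1 < w.im} := isOpen_lt continuous_const Complex.continuous_im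
    have hmem : z + 2 * I ∈ {w : ℂ | 1 < w.im} := by
      show 1 < (z + 2 * I).im
      simp; linarith
    filter_upwards [hopen.mem_nhds hmem] with w hw
    have hw' : 1 < w.im := hw
    have h := dirichletXi_mul_WChar_of_one_lt_im hr hχ heven hw'
    rw [hD]; dsimp only
    rw [Pi.zero_apply, sub_eq_zero, ← h]
    rfl
  have hD0 : EqOn D 0 {w : ℂ | y₀ < w.im} :=
    hDan.eqOn_zero_of_preconnected_of_eventuallyEq_zero hUc hz₁ hDev
  -- (C) `D` is continuous at `z` within `S = {Im w ≥ y₀}`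
  set T : Set ℂ := {w : ℂ | y₀ ≤ w.im} with hT
  have hΦcont : ContinuousWithinAt Φ T z := by
    refine continuousWithinAt_of_dominated (bound := fun t ↦ ‖F z t‖)
      (Eventually.of_forall hFmeas) ?_ hbound_int ?_
    · refine eventually_nhdsWithin_of_forall (fun w hw ↦ ?_)
      filter_upwards [ae_restrict_mem measurableSet_Ioi] with t ht
      exact hdom w hw t ht
    · filter_upwards [ae_restrict_mem measurableSet_Ioi] with t ht
      have ht0 : (t : ℂ) ≠ 0 := by exact_mod_cast (lt_trans one_pos (mem_Ioi.1 ht)).ne'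
      rw [hF]
      exact ((continuous_const.mul ((Continuous.const_cpow (by fun_prop) (Or.inl ht0)))).continuousWithinAt :
        ContinuousWithinAt (fun w : ℂ ↦ kChar χ t * (t : ℂ) ^ ((I * w - 1) / 2)) T z)
  have hDcont : ContinuousWithinAt D T z :=
    ((hξ1.continuous.continuousWithinAt).mul (continuousWithinAt_const.mul hΦcont)).sub
      (continuousWithinAt_const.mul hξ2.continuous.continuousWithinAt)
  -- (D) approach `z` from above
  set u : ℕ → ℂ := fun n ↦ z + ((1 / ((n : ℝ) + 1) : ℝ) : ℂ) * I with hu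
  have hu_mem : ∀ n, u n ∈ {w : ℂ | y₀ < w.im} := by
    intro n
    show y₀ < (u n).im
    rw [hu]; dsimp only
    simp only [Complex.add_im, Complex.mul_im, Complex.ofReal_re, Complex.I_im, Complex.ofReal_im,
      Complex.I_re, mul_zero, add_zero, mul_one]
    have : (0 : ℝ) < 1 / ((n : ℝ) + 1) := by positivity
    linarith
  have hu_T : ∀ n, u n ∈ T := fun n ↦ show y₀ ≤ (u n).im from le_of_lt (hu_mem n)
  have hu_lim : Tendsto u atTop (𝓝 z) := by
    have h0 : Tendsto (fun n : ℕ ↦ (((1 / ((n : ℝ) + 1) : ℝ)) : ℂ)) atTop (𝓝 0) := by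
      have := (Complex.continuous_ofReal.tendsto 0).comp tendsto_one_div_add_atTop_nhds_zero_nat
      rwa [Complex.ofReal_zero] at this
    have := (h0.mul_const I).const_add z
    rw [zero_mul, add_zero] at this
    exact this
  have hu_limT : Tendsto u atTop (𝓝[T] z) :=
    tendsto_nhdsWithin_iff.2 ⟨hu_lim, Eventually.of_forall hu_T⟩
  have hcomp : Tendsto (D ∘ u) atTop (𝓝 (D z)) := hDcont.tendsto.comp hu_limT
  have hzero : D ∘ u = fun _ ↦ 0 := funext fun n ↦ hD0 (hu_mem n)
  rw [hzero] at hcomp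
  exact (tendsto_nhds_unique tendsto_const_nhds hcomp).symm

/-! ## The discharge of `deBranges1986_thm4` -/

/-- **de Branges 1986, Theorem 4** — discharge of the named fact `deBranges1986_thm4` (as typed:
(i) `|ε(χ) ξ(1+iz, χ̄)| ≤ |ξ(1−iz, χ)|` on `Im z > 0`; (ii) under absolute convergence of the Mellin
integral, `|W_χ(z)| ≤ 1` and `ξ(1 − iz, χ) W_χ(z) = ε(χ) ξ(1 + iz, χ̄)`). (i) is
`deBranges1986_thm4_i` (Phragmén–Lindelöf, `DeBranges1986CharacterSpacesProofs.lean`); the identity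
in (ii) is `dirichletXi_mul_WChar` (explicit Mellin transform of `k_χ` — Beta integral and
`Σ φ(n)χ(n)n^{−s} = L(s−1,χ)/L(s,χ)` — on `Im z > 1`, analytic continuation below); `|W_χ| ≤ 1`
then follows from (i) since `ξ(1 − iz, χ) ≠ 0`. de Branges derives the bound from the isometries of
his Theorems 1–3; here the order is reversed. RH-FREE. [cite: deBranges1986, Theorem 4, pp. 11–12] -/
theorem deBranges1986_thm4_holds : deBranges1986_thm4 := by
  intro r _ χ hr hχ heven
  refine ⟨fun z hz ↦ deBranges1986_thm4_i r χ hr hχ heven z hz, fun z hz hint ↦ ?_⟩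
  have hid := dirichletXi_mul_WChar hr hχ heven hz hint
  refine ⟨?_, hid⟩
  have h1 : χ ≠ 1 := by
    rintro rfl
    rw [DirichletCharacter.isPrimitive_def, DirichletCharacter.conductor_one] at hχ
    exact hr hχ.symm
  have hξ : dirichletXi χ (1 - I * z) ≠ 0 :=
    dirichletXi_ne_zero_of_not_mem_strip hχ h1 (Or.inr (by
      simp only [Complex.sub_re, Complex.one_re, Complex.mul_re, Complex.I_re, Complex.I_im,
        zero_mul, one_mul, zero_sub]; linarith))
  have hW : WChar χ z = χ.rootNumber * dirichletXi χ⁻¹ (1 + I * z) / dirichletXi χ (1 - I * z) := by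
    rw [eq_div_iff hξ, mul_comm]; exact hid
  rw [hW, norm_div, div_le_one (norm_pos_iff.2 hξ)]
  exact deBranges1986_thm4_i r χ hr hχ heven z hz

end DeBranges1986
end Literature.Analysis.DeBrangesSpaces
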